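import Summits.AnomalousDissipation.AnomalousDissipation.Theorems.SolenoidalFractalHomogenisationLagrangianStepZ7AlphaBetaR
import Summits.AnomalousDissipation.AnomalousDissipation.Theorems.SolenoidalFractalHomogenisationLagrangianStepFrameCurvature
import HarnessLib

/-!
# K1L_D (stmt-AnomalousDissipation-27980): the registered stub `stub_Z7_alphaBetaR` CLOSED BY NAME

`stub_Z7_alphaBetaR : Z7Glue.cellInputs_alphaBeta_textR` (registry v24 of record, text `…LagrangianStepZ7GlueDefsR` p704133) is the composition of
this seat's assembly `Z7Glue.Z7_alphaBetaR_of_hcurv : HCURV → cellInputs_alphaBeta_textR` (p707880; prover ad-k1loc-p3 g9, assembler of record,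
tenure RULING D27-7) with the sharp frame-curvature bound K8-5 `FrameForm.abs_partialDeriv_frameG_le : HCURV` (p707845; prover lead-k1l-onelevel-p1 g6,
RULING D27-8/D27-8″; HCURV text of record = D27-8).  Same closing pattern as (J) `stub_effectiveFrameEnergyL_bandKill` (p705732).
`sorry`-free; NOT a proof of `stub_D1_V0R`, `stub_Vmod_of_VR(H)`, K1L_D or AD; rung F-D1.A0.
-/

set_option linter.dupNamespace false

noncomputable section

namespace Summit.AnomalousDissipation.AnomalousDissipation.Theorems.SolenoidalFractalHomogenisation.LagrangianStep

/-- **Registered stub `stub_Z7_alphaBetaR` (K1L_D registry v24), CLOSED**: the (αβ)-cell inputs in the guarded text of record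
`Z7Glue.cellInputs_alphaBeta_textR` — (α₁)(α₂) frame conjugacy on the two pieces of every grid window, (N1′)(N1*′) the guarded forward/adjoint
window losses, (N2) loss monotonicity — hold for every design `W.stretch M hM`: `Z7Glue.Z7_alphaBetaR_of_hcurv` (p707880) applied to K8-5
`FrameForm.abs_partialDeriv_frameG_le` (p707845). -/
theorem stub_Z7_alphaBetaR : Z7Glue.cellInputs_alphaBeta_textR :=
  Z7Glue.Z7_alphaBetaR_of_hcurv FrameForm.abs_partialDeriv_frameG_le

end Summit.AnomalousDissipation.AnomalousDissipation.Theorems.SolenoidalFractalHomogenisation.LagrangianStep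

end
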